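import Literature.AlgebraicGeometry.ModuliOfAbelianVarieties.SiegelModuliThickPoints
import Summits.HodgeConjecture.HodgeConjecture.Theorems.UeP4OfFPiece
import Summits.HodgeConjecture.HodgeConjecture.Theorems.SiegelUniversalFamilyHodgeFrames
import Summits.HodgeConjecture.HodgeConjecture.Theorems.SiegelClassifyEqOfAdmissible
import Summits.HodgeConjecture.HodgeConjecture.Theorems.UHeadGlueClassMap
import Summits.HodgeConjecture.CorCM.HypDel.M1primeOfFU
import Literature.AlgebraicGeometry.ModuliOfAbelianVarieties.SiegelFineModuliFibreTriples
import Literature.AlgebraicGeometry.ModuliOfAbelianVarieties.SiegelModuliComplexUniformisation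
import Literature.AlgebraicGeometry.Motives.ComplexPointsManifold
import Literature.AlgebraicGeometry.Motives.UniversalHypersurfaceQuasiProjective
import Literature.NumberTheory.ModularForms.SiegelSymplecticVolume
import Literature.Topology.Euclidean.InvarianceOfDimension
import Literature.Topology.Euclidean.InvarianceOfDomain
import Literature.Topology.Euclidean.DimensionOfSmoothBijection
import Literature.AlgebraicGeometry.ModuliOfAbelianVarieties.SiegelClassifyingMapLocalInverse
import Literature.Geometry.GeometricMeasureTheory.HausdorffLipschitzCover
import Mathlib.Data.Sym.Card
import HarnessLib

/-!
# E-road: THICK ⇔ NOT THIN on a smooth open piece of the Siegel moduli scheme, and `stub_le′` (piece dimension `≤ g(g+1)/2`)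

Cell hodgecm-mathlib (D-0151), E-road «EQUIDIM by proof» (skeleton `Cruxes/HDel/Lines/EquidimOfF.lean`, residual `stub_noThinPiece`),
Hecke-link line card v1.1; TREE EDITION of B-p01 (g13)'s HOME cert v9 §§ `StubLePrime` / `StubGePrime` / THICK-IFF with the P4-piece
socket DISCHARGED: every `hP4 : UHead.Ue_P4_piece` is now ★ `UeP4OfFPiece.ue_P4_piece_of_F hF` (lane T), so all heads depend on
(F) `lan2013_siegelFineModuliScheme` alone.  THEOREMS ONLY, `--as helper` capital for `stmt-HodgeConjecture-24835` (count-neutral).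
HC_CM is proved only modulo the 7 printed citations until rung 0 closes.

## The mathematics ([LangeBirkenhake1992] Ch. 8 §8.1–8.2; [Brouwer1911Dimension]; [Mattila1995] Thm. 7.5; [Klingen1990] Ch. I §1)

Let `𝓜 = 𝒜_{g,δ,N} ⊗ ℚ` be a Siegel fine moduli scheme ((F): [Lan2013PELCompactifications] Thm. 1.4.1.11, [MumfordFogartyKirwan1994]
Thm. 7.9), `ι : S′ ⟶ 𝓜_ℂ` an open immersion from a `ℂ`-scheme smooth of relative dimension `d`, `t` a complex point of `S′`.  The
P4-piece theorem gives, around `t` and for any principal reading `(Z₀, r, P₀)` of the triple at `ι t`, a local period map `π : W → 𝔥_g`,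
continuous, entrywise holomorphic in the algebraic charts of `S′(ℂ)` (★ `ComplexPoints.algebraicChart`), reading admissibility at `r`.
By ★ P6 (`UHead.classifyingMap_eq_of_isAdmissibleAt`: two triples admissible at the same `(Z, r)` have the same classifying point)
and `ι` mono, `π` is INJECTIVE on `W`; read in the chart at `t` and in the symmetrised coordinates `Z ↦ (Z i j + Z j i)_{i ≤ j}` of
symmetric matrices (`Sym2 (Fin g) → ℂ`, real dimension `g(g+1)`, = `2 · coordUHS` of [Klingen1990] on `𝔥_g`) it is a continuous
injection of an open of `ℝ^{2d}` into `ℝ^{g(g+1)}`, so `2d ≤ g(g+1)` by BROUWER's invariance of dimension ★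
`Topology.Euclidean.Brouwer.finrank_le_of_injOn_of_isOpen` (`stub_le′`).  Conversely, THICKNESS at `t` (★ `EquidimOfF.IsThickAtWith`:
the images `π(W ∩ chart source ∩ U)` contain opens of `𝔥_g` at every scale) forces `g(g+1)/2 ≤ d` by ★ (O4)
`Topology.Euclidean.finrank_complex_le_of_differentiableOn_of_nonempty_interior` (holomorphic map from an open of `ℂ^d` whose image has
interior; `le_of_isThickAt`), and if `g(g+1)/2 ≤ d` then `d = g(g+1)/2` and `π` in the chart is a continuous injection between spaces
of EQUAL real dimension, hence OPEN by invariance of DOMAIN ★ `Topology.Euclidean.Brouwer.isOpen_image_of_injOn` — so `t` is thick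
with respect to EVERY prescribed principal reading (`isThickAtWith_of_isAdmissibleAt`, the form socket (A) of the Hecke link consumes,
B-p08 (g9)) and in particular thick (`isThickAt_of_le`, `isThickAt_iff_le`).

## References
* [LangeBirkenhake1992] H. Lange, Ch. Birkenhake, *Complex Abelian Varieties* (1992), Ch. 8 §8.1–8.2.
* [Brouwer1911Dimension] L. E. J. Brouwer, *Beweis der Invarianz der Dimensionenzahl*, Math. Ann. 70 (1911), Satz 1 (p. 161).
* [Mattila1995] P. Mattila, *Geometry of Sets and Measures in Euclidean Spaces* (1995), Thm. 7.5.
* [Klingen1990] H. Klingen, *Introductory lectures on Siegel modular forms* (1990), Ch. I §1 Def. 2 (p. 2).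
* [MumfordFogartyKirwan1994] GIT 3rd ed., Ch. 7 §3 Thm. 7.9 (p. 139), App. 7A (p. 235).
-/

set_option autoImplicit false
set_option linter.dupNamespace false  -- `Summit.HodgeConjecture.HodgeConjecture.…` is the cell's layout (D-0017)

noncomputable section

open CategoryTheory CategoryTheory.Limits AlgebraicGeometry Matrix Topology
open Literature.AlgebraicGeometry
open Literature.AlgebraicGeometry.Motives (SchemeOver ComplexPoints AlgPoints specOver)
open Literature.AlgebraicGeometry.AbelianSchemes (PolarizedAbelianSchemeWithLevel)
open Literature.AlgebraicGeometry.ModuliOfAbelianVarieties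
open Literature.AlgebraicGeometry.ModuliOfAbelianVarieties.EquidimOfF
open Literature.NumberTheory.Automorphic (siegelUpperHalfSpace)
open Literature.NumberTheory.Adeles
open Literature.NumberTheory.ModularForms Literature.NumberTheory.ModularForms.SiegelUpperHalfSpace

namespace Summit.HodgeConjecture.HodgeConjecture.Theorems

namespace EquidimThickIffLe

open SiegelModuli

variable {g N : ℕ} {δ : Fin g → ℕ}

/-! ## §1 The symmetrised coordinates of symmetric matrices (linear algebra) -/

/-- The symmetrised coordinates `Z ↦ (s ↦ Z i j + Z j i)` are continuous. [cite: Klingen1990, Ch. I §1 Def. 2 (p. 2)] -/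
theorem continuous_symCoord (g : ℕ) :
    Continuous (fun (Z : Matrix (Fin g) (Fin g) ℂ) (s : Sym2 (Fin g)) ↦ Sym2.lift ⟨fun i j ↦ Z i j + Z j i, fun _ _ ↦ add_comm _ _⟩ s) := by
  refine continuous_pi fun s ↦ ?_
  induction s using Sym2.ind with
  | _ i j =>
    simp only [Sym2.lift_mk]
    fun_prop

/-- The symmetrised coordinates are injective on SYMMETRIC matrices. [cite: Klingen1990, Ch. I §1 Def. 2 (p. 2)] -/
theorem symCoord_injOn (g : ℕ) :
    Set.InjOn (fun (Z : Matrix (Fin g) (Fin g) ℂ) (s : Sym2 (Fin g)) ↦ Sym2.lift ⟨fun i j ↦ Z i j + Z j i, fun _ _ ↦ add_comm _ _⟩ s)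
      {Z : Matrix (Fin g) (Fin g) ℂ | Z.IsSymm} := by
  intro Z hZ Z' hZ' h
  ext i j
  have hij := congrFun h s(i, j)
  simp only [Sym2.lift_mk] at hij
  have h1 : Z j i = Z i j := by simpa using congrFun (congrFun hZ i) j
  have h2 : Z' j i = Z' i j := by simpa using congrFun (congrFun hZ' i) j
  rw [h1, h2, ← two_mul, ← two_mul] at hij
  exact mul_left_cancel₀ two_ne_zero hij

/-- `dim_ℝ (Sym2 (Fin g) → ℂ) = 2 · (g(g+1)/2)`. [cite: Klingen1990, Ch. I §1 Def. 2 (p. 2)] -/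
theorem finrank_real_sym2_fun (g : ℕ) : Module.finrank ℝ (Sym2 (Fin g) → ℂ) = 2 * (g * (g + 1) / 2) := by
  rw [Module.finrank_pi_fintype]
  simp only [Complex.finrank_real_complex, Finset.sum_const, Finset.card_univ, smul_eq_mul, Sym2.card,
    Fintype.card_fin, Nat.choose_two_right, Nat.add_sub_cancel]
  rw [Nat.mul_comm (g + 1) g, Nat.mul_comm _ 2]

/-! ## §2 `stub_le′`: a smooth open piece with a `ℂ`-point has relative dimension `≤ g(g+1)/2` (★ P4-piece + ★ Brouwer) -/

/-- **`stub_le′` (road (AN) of record): under the P4-piece socket, every open piece `ι : S′ ⟶ 𝓜_ℂ` smooth of pure relative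
dimension `d` that carries a `ℂ`-point has `d ≤ g(g+1)/2`** — the local period map on `S′` is a continuous injection (P6) from
a `d`-dimensional complex chart into the `g(g+1)/2`-dimensional space of symmetric matrices, so Brouwer's invariance of
dimension bounds `d`. [cite: Brouwer1911Dimension, Satz 1 (p. 161)] [cite: LangeBirkenhake1992, Ch. 8 §8.1]
[cite: MumfordFogartyKirwan1994, Appendix to Ch. 7 §A (p. 235)] -/
theorem stub_le' (hF : lan2013_siegelFineModuliScheme) (hg : 0 < g)
    (hδ : IsPolarizationType δ) (hN : 3 ≤ N) (𝓜 : SiegelFineModuliScheme g N δ)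
    (S' : SchemeOver ℂ) (ι : S' ⟶ (Motives.baseChange ℚ ℂ).obj 𝓜.M) [IsOpenImmersion ι.left]
    (d : ℕ) [hd : SmoothOfRelativeDimension d S'.hom]
    (q : Spec (CommRingCat.of ℂ) ⟶ S'.left) (hq : q ≫ S'.hom = 𝟙 _) :
    d ≤ g * (g + 1) / 2 := by
  classical
  haveI hLN : IsLocallyNoetherian (specOver ℚ ℂ).left :=
    inferInstanceAs (IsLocallyNoetherian (Spec (CommRingCat.of ℂ)))
  haveI : Smooth S'.hom := SmoothOfRelativeDimension.smooth d _
  haveI : LocallyOfFiniteType S'.hom := inferInstance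
  -- quasi-projectivity of the piece, from (F)
  obtain ⟨-, hMq, -⟩ := W1.smooth_qproj_of_F hF hg hδ hN 𝓜
  have hSq : HodgeTheory.IsQuasiProjectiveOver S' :=
    HodgeTheory.IsQuasiProjectiveOver.of_isOpenImmersion ι
      (Summit.HodgeConjecture.HodgeConjecture.Theorems.UnivFamilyHodgeFrames.isQuasiProjectiveOver_baseChange_M 𝓜 hMq)
  -- the `ℂ`-point `t₀` of `S′`
  have hq' : q ≫ S'.hom = (specOver ℂ ℂ).hom := by
    rw [hq]
    change 𝟙 _ = Spec.map (CommRingCat.ofHom (algebraMap ℂ ℂ))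
    rw [Algebra.algebraMap_self, CommRingCat.ofHom_id, Spec.map_id]
  let t₀ : ComplexPoints S' := Over.homMk q hq'
  -- the fibre triple at `ι t₀` and a principal residue representative at which it is admissible
  obtain ⟨P₀, -, -, -, hx₀⟩ := 𝓜.exists_triple_isBaseChangeVia_classifyingPoint_eq (AlgPoints.map (L := ℂ) ι t₀)
  obtain ⟨-, -, r, -, -, hr1, -, -, Z₀, hZ₀, hadm⟩ :=
    Summit.HodgeConjecture.CorCM.HypDel.UHead.exists_residue_isAdmissibleAt hg hδ hN P₀
  -- the P4-piece period map on an open `W ∋ t₀`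
  obtain ⟨W, π, hWo, ht₀W, -, hπc, -, hread⟩ :=
    UeP4OfFPiece.ue_P4_piece_of_F hF g N δ hg hδ hN 𝓜 r ι hSq d hr1 Z₀ hZ₀ P₀ hadm t₀ hx₀.symm
  -- `π` is injective on `W` (P6 + `ι` mono) and symmetric-valued
  have hsymm : ∀ x ∈ W, (π x).IsSymm := fun x hx ↦
    ((Literature.NumberTheory.Automorphic.mem_siegelUpperHalfSpace_iff).1 (hread x hx).1).1
  have key : ∀ {Z Z' : Matrix (Fin g) (Fin g) ℂ} (_ : Z = Z') (hZ : Z ∈ siegelUpperHalfSpace g)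
      (hZ' : Z' ∈ siegelUpperHalfSpace g) (P : PolarizedAbelianSchemeWithLevel g N δ (specOver ℚ ℂ).left),
      IsAdmissibleAt hδ r Z' hZ' P → IsAdmissibleAt hδ r Z hZ P := by
    rintro Z Z' rfl hZ hZ' P h
    exact h
  have hinjW : Set.InjOn π W := by
    intro x hx y hy hxy
    obtain ⟨hxZ, Px, hPx, hclsx⟩ := hread x hx
    obtain ⟨hyZ, Py, hPy, hclsy⟩ := hread y hy
    have hcls : 𝓜.classifyingMap (specOver ℚ ℂ) Px = 𝓜.classifyingMap (specOver ℚ ℂ) Py :=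
      Summit.HodgeConjecture.CorCM.HypDel.UHead.classifyingMap_eq_of_isAdmissibleAt g N δ hg hδ hN 𝓜 r hr1 (π x) hxZ
        Px Py hPx (key hxy hxZ hyZ Py hPy)
    have hmap : AlgPoints.map (L := ℂ) ι x = AlgPoints.map (L := ℂ) ι y := by rw [← hclsx, ← hclsy, hcls]
    have hleft : x.left = y.left := by
      have h := congrArg CommaMorphism.left hmap
      simp only [AlgPoints.map_apply, Over.comp_left] at h
      exact (cancel_mono ι.left).1 h
    exact Over.OverMorphism.ext hleft
  -- the algebraic chart at `t₀` and the coordinate map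
  let e := ComplexPoints.algebraicChart S' d t₀
  have ht₀e : t₀ ∈ e.source := ComplexPoints.mem_algebraicChart_source S' d t₀
  let U : Set (Fin d → ℂ) := e.target ∩ e.symm ⁻¹' W
  have hUo : IsOpen U := e.isOpen_inter_preimage_symm hWo
  have hUne : U.Nonempty := ⟨e t₀, e.map_source ht₀e, by
    show e.symm (e t₀) ∈ W
    rw [e.left_inv ht₀e]; exact ht₀W⟩
  let f : (Fin d → ℂ) → (Sym2 (Fin g) → ℂ) := fun v ↦ (fun (Z : Matrix (Fin g) (Fin g) ℂ) (s : Sym2 (Fin g)) ↦ Sym2.lift ⟨fun i j ↦ Z i j + Z j i, fun _ _ ↦ add_comm _ _⟩ s) (π (e.symm v))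
  have hπe : ContinuousOn (fun v ↦ π (e.symm v)) U :=
    hπc.comp (e.continuousOn_symm.mono Set.inter_subset_left) (fun v hv ↦ hv.2)
  have hfc : ContinuousOn f U := (continuous_symCoord g).comp_continuousOn hπe
  have hfinj : Set.InjOn f U := by
    intro v hv v' hv' hvv'
    have h1 : π (e.symm v) = π (e.symm v') :=
      symCoord_injOn g (hsymm _ hv.2) (hsymm _ hv'.2) hvv'
    have h2 : e.symm v = e.symm v' := hinjW hv.2 hv'.2 h1
    exact e.symm.injOn hv.1 hv'.1 h2
  -- Brouwer
  have hB := Literature.Topology.Euclidean.Brouwer.finrank_le_of_injOn_of_isOpen hUo hUne hfc hfinj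
  rw [Literature.Geometry.GeometricMeasureTheory.finrank_real_pi_complex, finrank_real_sym2_fun] at hB
  omega

/-! ## §3 Klingen's coordinates on `𝔥_g` and the symmetrised coordinates -/

/-- On `𝔥_g`, the symmetrised coordinates are twice Klingen's coordinate map `coordUHS`. [cite: Klingen1990, Ch. I §1 Def. 2 (p. 2)] -/
theorem symCoord_coe (z : siegelUpperHalfSpace g) :
    (fun (Z : Matrix (Fin g) (Fin g) ℂ) (s : Sym2 (Fin g)) ↦ Sym2.lift ⟨fun i j ↦ Z i j + Z j i, fun _ _ ↦ add_comm _ _⟩ s)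
      (z : Matrix (Fin g) (Fin g) ℂ) = (2 : ℂ) • coordUHS z := by
  ext s
  induction s using Sym2.ind with
  | _ i j =>
    simp only [Sym2.lift_mk, Pi.smul_apply, coordUHS_apply_mk, smul_eq_mul]
    have h : (z : Matrix (Fin g) (Fin g) ℂ) j i = (z : Matrix (Fin g) (Fin g) ℂ) i j := z.2.1.apply i j
    rw [h, two_mul]

/-! ## §4 THICK ⇒ `g(g+1)/2 ≤ d` (★ (O4)) -/

/-- **A smooth open piece of `𝓜_ℂ` that is THICK at a complex point has relative dimension `≥ g(g+1)/2`**: in the algebraic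
chart at `t` and Klingen's coordinates, the period map is a holomorphic map from an open of `ℂ^d` whose image contains an
open of `ℂ^{g(g+1)/2}`, so (O4) bounds the dimensions. [cite: Mattila1995, Thm. 7.5] [cite: LangeBirkenhake1992, Ch. 8 §8.1] -/
theorem le_of_isThickAt (hδ : IsPolarizationType δ) (𝓜 : SiegelFineModuliScheme g N δ) {S' : SchemeOver ℂ}
    (ι : S' ⟶ (Motives.baseChange ℚ ℂ).obj 𝓜.M) (d : ℕ) [SmoothOfRelativeDimension d S'.hom]
    (t : ComplexPoints S') (h : IsThickAt hδ 𝓜 ι d t) : g * (g + 1) / 2 ≤ d := by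
  haveI : Smooth S'.hom := SmoothOfRelativeDimension.smooth d _
  haveI : LocallyOfFiniteType S'.hom := inferInstance
  obtain ⟨r, -, W, π, hWo, htW, -, hπhol, -, hsc⟩ := h
  obtain ⟨V, hVo, hVne, hVsub⟩ := hsc Set.univ isOpen_univ (Set.mem_univ t)
  let e := ComplexPoints.algebraicChart S' d t
  let U : Set (Fin d → ℂ) := e.target ∩ e.symm ⁻¹' W
  have hUo : IsOpen U := e.isOpen_inter_preimage_symm hWo
  let f : (Fin d → ℂ) → (Sym2 (Fin g) → ℂ) := fun v ↦ (fun (Z : Matrix (Fin g) (Fin g) ℂ) (s : Sym2 (Fin g)) ↦ Sym2.lift ⟨fun i j ↦ Z i j + Z j i, fun _ _ ↦ add_comm _ _⟩ s) (π (e.symm v))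
  -- holomorphy of `f` on `U` from the ENTRYWISE chart-holomorphy at `t` (no norm on matrices is used)
  have hf : DifferentiableOn ℂ f U := by
    refine differentiableOn_pi.2 fun s ↦ ?_
    induction s using Sym2.ind with
    | _ i j =>
      have hij : DifferentiableOn ℂ (fun v ↦ π (e.symm v) i j + π (e.symm v) j i) U :=
        (hπhol t htW i j).add (hπhol t htW j i)
      simpa only [f, Sym2.lift_mk] using hij
  -- the image of `f` contains the open non-empty set `2 • coordUHS(V)`
  have hsub : (fun w : Sym2 (Fin g) → ℂ ↦ (2 : ℂ) • w) '' (coordUHS '' V) ⊆ f '' U := by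
    rintro _ ⟨_, ⟨z, hzV, rfl⟩, rfl⟩
    obtain ⟨x, ⟨⟨hxW, hxsrc⟩, -⟩, hx⟩ := hVsub ⟨z, hzV, rfl⟩
    refine ⟨e x, ⟨e.map_source hxsrc, ?_⟩, ?_⟩
    · show e.symm (e x) ∈ W
      rw [e.left_inv hxsrc]
      exact hxW
    · show (fun (Z : Matrix (Fin g) (Fin g) ℂ) (s : Sym2 (Fin g)) ↦ Sym2.lift ⟨fun i j ↦ Z i j + Z j i, fun _ _ ↦ add_comm _ _⟩ s) (π (e.symm (e x))) = (2 : ℂ) • coordUHS z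
      rw [e.left_inv hxsrc, hx, symCoord_coe]
  have hopen : IsOpen ((fun w : Sym2 (Fin g) → ℂ ↦ (2 : ℂ) • w) '' (coordUHS '' V)) :=
    isOpenMap_smul₀ two_ne_zero _ (isOpen_image_coordUHS hVo)
  have hint : (interior (f '' U)).Nonempty := by
    obtain ⟨z, hz⟩ := hVne
    refine ⟨(2 : ℂ) • coordUHS z, interior_mono hsub ?_⟩
    rw [hopen.interior_eq]
    exact ⟨coordUHS z, ⟨z, hz, rfl⟩, rfl⟩
  have hle := Literature.Topology.Euclidean.finrank_complex_le_of_differentiableOn_of_nonempty_interior hUo hf hint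
  rwa [SiegelLocalInverse.finrank_sym2_fun, Module.finrank_fin_fun] at hle

/-- **`stub_ge′` from `stub_thick`**: if every complex point of every smooth open piece is thick, every such piece with a
`ℂ`-point has relative dimension `≥ g(g+1)/2` (the v1.1 shape: `stub_ge′ := stub_ge'_of_thick stub_thick`). -/
theorem stub_ge'_of_thick (hδ : IsPolarizationType δ) (𝓜 : SiegelFineModuliScheme g N δ)
    (hthick : ∀ (S' : SchemeOver ℂ) (ι : S' ⟶ (Motives.baseChange ℚ ℂ).obj 𝓜.M) [IsOpenImmersion ι.left]
      (d : ℕ) [SmoothOfRelativeDimension d S'.hom] (t : ComplexPoints S'), IsThickAt hδ 𝓜 ι d t)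
    (S' : SchemeOver ℂ) (ι : S' ⟶ (Motives.baseChange ℚ ℂ).obj 𝓜.M) [IsOpenImmersion ι.left]
    (d : ℕ) [SmoothOfRelativeDimension d S'.hom]
    (q : Spec (CommRingCat.of ℂ) ⟶ S'.left) (hq : q ≫ S'.hom = 𝟙 _) : g * (g + 1) / 2 ≤ d := by
  have hq' : q ≫ S'.hom = (specOver ℂ ℂ).hom := by
    rw [hq]
    change 𝟙 _ = Spec.map (CommRingCat.ofHom (algebraMap ℂ ℂ))
    rw [Algebra.algebraMap_self, CommRingCat.ofHom_id, Spec.map_id]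
  exact le_of_isThickAt hδ 𝓜 ι d (Over.homMk q hq') (hthick S' ι d _)

/-! ## §5 NOT THIN ⇒ THICK (★ P4-piece + ★ invariance of domain); THICK ⇔ NOT THIN -/

/-- **NOT THIN ⇒ THICK AT EVERY PRESCRIBED PRINCIPAL READING (REAL over the P4-piece socket + ★ invariance of DOMAIN)**: on
a smooth open piece of relative dimension `d ≥ g(g+1)/2` (hence `= g(g+1)/2` by `stub_le′`), a complex point `t` whose triple
reads admissible at `(Z, r)` for a principal `r` is THICK WITH RESPECT TO THAT `r` — the P4-piece period map at `(Z, r, P₀)`, read in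
the chart at `t` and symmetrised coordinates, is a continuous injection between spaces of EQUAL real dimension, so its image is
open (★ `Brouwer.isOpen_image_of_injOn`).  Socket (A) of the Hecke link needs the reading PRESCRIBED (B-p08 (g9) 20:14:03Z: the
representative `r′ = r·u` forced by `QuotientAdapted`), not chosen. [cite: Brouwer1911Dimension, Satz 1 (p. 161)]
[cite: LangeBirkenhake1992, Ch. 8 §8.1] -/
theorem isThickAtWith_of_isAdmissibleAt (hF : lan2013_siegelFineModuliScheme) (hg : 0 < g)
    (hδ : IsPolarizationType δ) (hN : 3 ≤ N) (𝓜 : SiegelFineModuliScheme g N δ)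
    {S' : SchemeOver ℂ} (ι : S' ⟶ (Motives.baseChange ℚ ℂ).obj 𝓜.M) [IsOpenImmersion ι.left]
    (d : ℕ) [hd : SmoothOfRelativeDimension d S'.hom] (t : ComplexPoints S') (hGd : g * (g + 1) / 2 ≤ d)
    {r : gspFinAdelic δ} (hr1 : r ∈ principalLevelSubgroup δ 1) {Z : siegelUpperHalfSpace g}
    (P₀ : PolarizedAbelianSchemeWithLevel g N δ (specOver ℚ ℂ).left) (hadm : IsAdmissibleAt hδ r Z.1 Z.2 P₀)
    (hcls :
      haveI : IsLocallyNoetherian (specOver ℚ ℂ).left := inferInstanceAs (IsLocallyNoetherian (Spec (CommRingCat.of ℂ)))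
      AlgPoints.baseChangeEquiv (algebraMap ℚ ℂ) 𝓜.M (𝓜.classifyingMap (specOver ℚ ℂ) P₀) = AlgPoints.map (L := ℂ) ι t) :
    IsThickAtWith hδ 𝓜 ι d t r := by
  classical
  haveI hLN : IsLocallyNoetherian (specOver ℚ ℂ).left :=
    inferInstanceAs (IsLocallyNoetherian (Spec (CommRingCat.of ℂ)))
  haveI : Smooth S'.hom := SmoothOfRelativeDimension.smooth d _
  haveI : LocallyOfFiniteType S'.hom := inferInstance
  -- quasi-projectivity of the piece, from (F)
  obtain ⟨-, hMq, -⟩ := W1.smooth_qproj_of_F hF hg hδ hN 𝓜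
  have hSq : HodgeTheory.IsQuasiProjectiveOver S' :=
    HodgeTheory.IsQuasiProjectiveOver.of_isOpenImmersion ι
      (Summit.HodgeConjecture.HodgeConjecture.Theorems.UnivFamilyHodgeFrames.isQuasiProjectiveOver_baseChange_M 𝓜 hMq)
  -- the dimension is exactly `g(g+1)/2` (`stub_le′` applied at the section underlying `t`)
  have htq : t.left ≫ S'.hom = 𝟙 _ := by
    rw [Over.w t]
    change Spec.map (CommRingCat.ofHom (algebraMap ℂ ℂ)) = 𝟙 _
    rw [Algebra.algebraMap_self, CommRingCat.ofHom_id, Spec.map_id]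
  have hdG : d = g * (g + 1) / 2 := le_antisymm (stub_le' hF hg hδ hN 𝓜 S' ι d t.left htq) hGd
  -- the P4-piece period map at the PRESCRIBED reading `(Z, r, P₀)`
  obtain ⟨W, π, hWo, htW, hπ0, hπc, hπhol, hread⟩ :=
    UeP4OfFPiece.ue_P4_piece_of_F hF g N δ hg hδ hN 𝓜 r ι hSq d hr1 Z.1 Z.2 P₀ hadm t hcls.symm
  -- `π` is injective on `W` and symmetric-valued
  have hsymm : ∀ x ∈ W, (π x).IsSymm := fun x hx ↦
    ((Literature.NumberTheory.Automorphic.mem_siegelUpperHalfSpace_iff).1 (hread x hx).1).1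
  have key : ∀ {Z Z' : Matrix (Fin g) (Fin g) ℂ} (_ : Z = Z') (hZ : Z ∈ siegelUpperHalfSpace g)
      (hZ' : Z' ∈ siegelUpperHalfSpace g) (P : PolarizedAbelianSchemeWithLevel g N δ (specOver ℚ ℂ).left),
      IsAdmissibleAt hδ r Z' hZ' P → IsAdmissibleAt hδ r Z hZ P := by
    rintro Z Z' rfl hZ hZ' P h
    exact h
  have hinjW : Set.InjOn π W := by
    intro x hx y hy hxy
    obtain ⟨hxZ, Px, hPx, hclsx⟩ := hread x hx
    obtain ⟨hyZ, Py, hPy, hclsy⟩ := hread y hy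
    have hcls : 𝓜.classifyingMap (specOver ℚ ℂ) Px = 𝓜.classifyingMap (specOver ℚ ℂ) Py :=
      Summit.HodgeConjecture.CorCM.HypDel.UHead.classifyingMap_eq_of_isAdmissibleAt g N δ hg hδ hN 𝓜 r hr1 (π x) hxZ
        Px Py hPx (key hxy hxZ hyZ Py hPy)
    have hmap : AlgPoints.map (L := ℂ) ι x = AlgPoints.map (L := ℂ) ι y := by rw [← hclsx, ← hclsy, hcls]
    have hleft : x.left = y.left := by
      have h := congrArg CommaMorphism.left hmap
      simp only [AlgPoints.map_apply, Over.comp_left] at h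
      exact (cancel_mono ι.left).1 h
    exact Over.OverMorphism.ext hleft
  -- the chart at `t`, the coordinate map, and invariance of DOMAIN in equal dimension
  let e := ComplexPoints.algebraicChart S' d t
  have hte : t ∈ e.source := ComplexPoints.mem_algebraicChart_source S' d t
  let U : Set (Fin d → ℂ) := e.target ∩ e.symm ⁻¹' W
  have hUo : IsOpen U := e.isOpen_inter_preimage_symm hWo
  let f : (Fin d → ℂ) → (Sym2 (Fin g) → ℂ) := fun v ↦ (fun (Z : Matrix (Fin g) (Fin g) ℂ) (s : Sym2 (Fin g)) ↦ Sym2.lift ⟨fun i j ↦ Z i j + Z j i, fun _ _ ↦ add_comm _ _⟩ s) (π (e.symm v))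
  have hπe : ContinuousOn (fun v ↦ π (e.symm v)) U :=
    hπc.comp (e.continuousOn_symm.mono Set.inter_subset_left) (fun v hv ↦ hv.2)
  have hfc : ContinuousOn f U := (continuous_symCoord g).comp_continuousOn hπe
  have hfinj : Set.InjOn f U := by
    intro v hv v' hv' hvv'
    have h1 : π (e.symm v) = π (e.symm v') := symCoord_injOn g (hsymm _ hv.2) (hsymm _ hv'.2) hvv'
    exact e.symm.injOn hv.1 hv'.1 (hinjW hv.2 hv'.2 h1)
  have hdim : Module.finrank ℝ (Fin d → ℂ) = Module.finrank ℝ (Sym2 (Fin g) → ℂ) := by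
    rw [Literature.Geometry.GeometricMeasureTheory.finrank_real_pi_complex, finrank_real_sym2_fun, hdG]
  refine ⟨W, π, hWo, htW, hπc, hπhol, hread, fun O hOo htO ↦ ?_⟩
  -- at every scale `O ∋ t`: the image of `e.target ∩ e.symm ⁻¹' (W ∩ O)` is open by invariance of domain
  let U' : Set (Fin d → ℂ) := e.target ∩ e.symm ⁻¹' (W ∩ O)
  have hU'o : IsOpen U' := e.isOpen_inter_preimage_symm (hWo.inter hOo)
  have hU'U : U' ⊆ U := fun v hv ↦ ⟨hv.1, hv.2.1⟩
  have hopen : IsOpen (f '' U') :=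
    Literature.Topology.Euclidean.Brouwer.isOpen_image_of_injOn hdim hU'o (hfc.mono hU'U) (hfinj.mono hU'U)
  let V : Set (siegelUpperHalfSpace g) := {z | (fun (Z : Matrix (Fin g) (Fin g) ℂ) (s : Sym2 (Fin g)) ↦ Sym2.lift ⟨fun i j ↦ Z i j + Z j i, fun _ _ ↦ add_comm _ _⟩ s) (z : Matrix (Fin g) (Fin g) ℂ) ∈ f '' U'}
  have hVo : IsOpen V := hopen.preimage ((continuous_symCoord g).comp continuous_subtype_val)
  have htU' : e t ∈ U' := ⟨e.map_source hte, by
    show e.symm (e t) ∈ W ∩ O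
    rw [e.left_inv hte]; exact ⟨htW, htO⟩⟩
  have hVne : V.Nonempty := by
    refine ⟨⟨π t, (hread t htW).1⟩, e t, htU', ?_⟩
    show (fun (Z : Matrix (Fin g) (Fin g) ℂ) (s : Sym2 (Fin g)) ↦ Sym2.lift ⟨fun i j ↦ Z i j + Z j i, fun _ _ ↦ add_comm _ _⟩ s) (π (e.symm (e t))) = (fun (Z : Matrix (Fin g) (Fin g) ℂ) (s : Sym2 (Fin g)) ↦ Sym2.lift ⟨fun i j ↦ Z i j + Z j i, fun _ _ ↦ add_comm _ _⟩ s) (π t)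
    rw [e.left_inv hte]
  have hVsub : Subtype.val '' V ⊆ π '' (W ∩ e.source ∩ O) := by
    rintro _ ⟨z, hz, rfl⟩
    obtain ⟨v, hvU, hv⟩ := hz
    refine ⟨e.symm v, ⟨⟨hvU.2.1, e.map_target hvU.1⟩, hvU.2.2⟩, ?_⟩
    exact symCoord_injOn g (hsymm _ hvU.2.1) z.2.1 hv
  exact ⟨V, hVo, hVne, hVsub⟩

/-- **NOT THIN ⇒ THICK (REAL over the P4-piece socket + ★ invariance of DOMAIN)**: on a smooth open piece of relative dimension
`d ≥ g(g+1)/2` (hence `= g(g+1)/2` by `stub_le′`) every complex point is THICK — `isThickAtWith_of_isAdmissibleAt` at the residue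
reading of the fibre triple (★ `exists_triple_isBaseChangeVia_classifyingPoint_eq`, ★ `UHead.exists_residue_isAdmissibleAt`).  With
`le_of_isThickAt` this makes THICK ⇔ NOT THIN a two-way ★-shaped bridge, so `StubThick ⇔ NoThinPiece` given G-AN1.
[cite: Brouwer1911Dimension, Satz 1 (p. 161)] [cite: LangeBirkenhake1992, Ch. 8 §8.1] -/
theorem isThickAt_of_le (hF : lan2013_siegelFineModuliScheme) (hg : 0 < g)
    (hδ : IsPolarizationType δ) (hN : 3 ≤ N) (𝓜 : SiegelFineModuliScheme g N δ)
    {S' : SchemeOver ℂ} (ι : S' ⟶ (Motives.baseChange ℚ ℂ).obj 𝓜.M) [IsOpenImmersion ι.left]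
    (d : ℕ) [hd : SmoothOfRelativeDimension d S'.hom] (hGd : g * (g + 1) / 2 ≤ d) (t : ComplexPoints S') :
    IsThickAt hδ 𝓜 ι d t := by
  haveI hLN : IsLocallyNoetherian (specOver ℚ ℂ).left :=
    inferInstanceAs (IsLocallyNoetherian (Spec (CommRingCat.of ℂ)))
  obtain ⟨P₀, -, -, -, hx₀⟩ := 𝓜.exists_triple_isBaseChangeVia_classifyingPoint_eq (AlgPoints.map (L := ℂ) ι t)
  obtain ⟨-, -, r, -, -, hr1, -, -, Z₀, hZ₀, hadm⟩ :=
    Summit.HodgeConjecture.CorCM.HypDel.UHead.exists_residue_isAdmissibleAt hg hδ hN P₀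
  exact ⟨r, hr1, isThickAtWith_of_isAdmissibleAt hF hg hδ hN 𝓜 ι d t hGd hr1 (Z := ⟨Z₀, hZ₀⟩) P₀ hadm hx₀⟩

/-- **THICK ⇔ NOT THIN, pointwise (REAL over the P4-piece socket)**: on a smooth open piece with a complex point `t`,
`IsThickAt … t ↔ g(g+1)/2 ≤ d`. [cite: Brouwer1911Dimension, Satz 1 (p. 161)] -/
theorem isThickAt_iff_le (hF : lan2013_siegelFineModuliScheme) (hg : 0 < g)
    (hδ : IsPolarizationType δ) (hN : 3 ≤ N) (𝓜 : SiegelFineModuliScheme g N δ)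
    {S' : SchemeOver ℂ} (ι : S' ⟶ (Motives.baseChange ℚ ℂ).obj 𝓜.M) [IsOpenImmersion ι.left]
    (d : ℕ) [SmoothOfRelativeDimension d S'.hom] (t : ComplexPoints S') :
    IsThickAt hδ 𝓜 ι d t ↔ g * (g + 1) / 2 ≤ d :=
  ⟨le_of_isThickAt hδ 𝓜 ι d t, fun h ↦ isThickAt_of_le hF hg hδ hN 𝓜 ι d h t⟩

end EquidimThickIffLe

end Summit.HodgeConjecture.HodgeConjecture.Theorems

end
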